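import Summits.HodgeConjecture.HodgeConjecture.Theorems.R90S4NormSectionOfRegular       -- ★ p863172 (this seat): `exists_normSection`, `isNormSection_iff_ae_isRegularElt`, `isTwistedWeylMeasure_iff_of_forall_isEpsNormPair`; brings ★ p862981 `R90S4OneDimCharTransferOfWeylPair` (`IsStableWeylMeasure`, `IsTwistedWeylMeasure`, `IsNormSection`, `splitFormGL`) and ★ `R90S4TwistedWeylSectionIndep` (`IsTwistedWeylMeasure.congr_normSection`, `IsNormSection.ae_isRegularElt`)
import HarnessLib

/-!
# R90-TF · S4 «Ch. 13.1–2», (1D-CT) road — THE (W-NP) SOCKET «WEYL NORM PAIR» FROM TWO MEASURE-LEVEL LETTERS: a stable Weyl measure `ρ` carried by the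
# regular set which is also a twisted Weyl datum along SOME everywhere-norm section (Rogawski 1990, §12.5 pp. 182, 186–187; §3.11 Prop. 3.11.1 (b) p. 34)

Cell `hodgecm-mathlib`, crux H413 (`stmt-HodgeConjecture-24833`, lane `--supports … --as helper`), route of record `HCCMUnconditional` (no route verbs;
count-neutral).  Programme R90-TF, section S4 = [Rogawski1990] Ch. 13.1–13.2; seat R90-C131-p03 (g2), DEALT BY NAME by the S4 dealer K2E2-plan (g7), RULING
S4-R18 (3) (2026-09-05T00:03:02Z; generality of `sec₀` confirmed S4-R21): the HYPOTHESIS-FIRST reduction of the (W-NP) socket `stub_R90_S4_weylNormPair` of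
`Cruxes/H413/Lines/R90_S4_LocalBaseChangeC.lean` ED. 5 (K2E3-p12 (g10) PRECERT §1) — whose ∃-BODY `∃ ρ sec, IsStableWeylMeasure … ρ ∧ IsTwistedWeylMeasure … ρ sec ∧
IsNormSection … ρ sec` is what ★ p862981 `oneDimCharTransfer_of_weylPair` consumes to pay (1D-CT)ₙₛ — to two measure-level letters: (B2-S) «`ρ` is a stable Weyl measure
for `(νG, mG)`, carried by the regular set» and (B1) «`(ρ, sec₀)` is a twisted Weyl datum for `(νGt, mGt)`» for ANY section `sec₀` with `γ ∈ 𝒩(sec₀ γ)` everywhere.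
THEOREMS ONLY — no `def`, no instance, no notation, no named-fact hypothesis, no `sorry`; ★-only imports (one S4 `Theorems` file), never `Lines`.

HONEST LABEL: HC_CM is proved only modulo the 7 printed citations (2 remaining named inputs: hLiu418 = stmt-HodgeConjecture-24832, h413 =
stmt-HodgeConjecture-24833) until rung 0 closes.  This file discharges no socket by itself: it is the glue by which C ED. 6 pays (W-NP) by `obtain` + `exact` from
the two letters (B2-S) (stable regrouping of ★ p863297's plain Weyl measure — census-first, K2E3-p12 (g10)) and (B1) (T-WIF, the ε-twisted Weyl integration formula —
OPEN, crux-sized); REL ≠ ★ ≠ BUILT.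

## The mathematics

PRINT.  [Rogawski1990, §12.5 p. 187]: «The Weyl integration formula implies `∫_{Z̃\G̃} φ(g) α̃(g) dg = ∫_{Z\G} f(g) α(g) dg`» — read off the ε-twisted formula (p. 186,
torus variable `δ ∈ Z̃T̃ᴺ\T̃ = Z\T` through the norm) and the stable formula (p. 182) with the SAME torus-side measure, along a section of the norm map
(Prop. 3.11.1 (b): every semisimple `γ` is a norm `N(δ)` with `G̃_{δε} = G_γ`).  The tree's (W-NP) socket asks for exactly such a triple `(ρ, sec)`:
`IsStableWeylMeasure L Φ v νG mG ρ` (p. 182), `IsTwistedWeylMeasure L Φ v νGt mGt ρ sec` (p. 186, norm-parametrised), `IsNormSection L Φ v ρ sec` (`ρ`-a.e. `sec γ`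
ε-regular with `γ ∈ 𝒩(sec γ)`).  By ★ `isNormSection_iff_ae_isRegularElt` the third conjunct, for a section with `γ ∈ 𝒩(sec γ)` EVERYWHERE (such sections exist
for every `Φ`: ★ `exists_normSection`), IS «`ρ`-a.e. `γ` is regular semisimple» — which the torus-side measure `ρ = Σ_T |Ω_F(T,G)|⁻¹ (ι_T)_*(D_G² dγ)` satisfies by
construction (★ p863297 `exists_isPlainWeylMeasure` exports it).  Hence:
* §1 **`exists_weylNormPair_of_stable_twisted`** (any `Φ`) and **`weylNormPair_of_stable_twisted`** (form of record `splitFormGL L`; ∃-body = the socket's, token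
  for token): `(∀ᵐ γ ∂ρ, γ regular) → IsStableWeylMeasure … ρ → (∀ γ, γ ∈ 𝒩(sec₀ γ)) → IsTwistedWeylMeasure … ρ sec₀ → ∃ ρ sec, S ∧ T ∧ N` — witnesses `ρ, sec₀`.
* §2 **`weylNormPair_of_stable_twisted_normSection`**: the same letters give the ∃-body with, IN ADDITION, `N(sec γ) = γ` for EVERY `γ` (swap `sec₀` for the global
  section of record of ★ `exists_normSection` by ★ `isTwistedWeylMeasure_iff_of_forall_isEpsNormPair` — the twisted Weyl datum does not see which norm section is used).
* §3 **`weylNormPair_iff_exists_ae_isRegularElt`**: THE CUT IS LOSSLESS — the (W-NP) ∃-body is EQUIVALENT to `∃ ρ sec, (∀ γ, γ ∈ 𝒩(sec γ)) ∧ (∀ᵐ γ ∂ρ, γ regular) ∧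
  S ∧ T` (`⇒`: ★ `IsNormSection.ae_isRegularElt`, then move T-WIF to the global section by ★ `IsTwistedWeylMeasure.congr_normSection`).

[cite: Rogawski1990, §12.5 pp. 182, 186–187; §3.11 Prop. 3.11.1 (b) p. 34; §4.3 p. 43]
-/

set_option autoImplicit false
-- the mandated namespace repeats the single-problem summit's segment (`HodgeConjecture.HodgeConjecture`)
set_option linter.dupNamespace false

noncomputable section

open MeasureTheory
open scoped NumberField Matrix MatrixGroups

namespace Summit.HodgeConjecture.HodgeConjecture.R90.S4

open Literature.NumberTheory.Rogawski1990 Literature.NumberTheory.Rogawski1990.Ch4Sec10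
open Literature.NumberTheory.Automorphic Literature.NumberTheory.Automorphic.UnitaryGroup
open IsDedekindDomain NumberField

variable (L : Type) [Field L] [NumberField L] [IsCMField L] (Φ : GL (Fin 3) L) (v : HeightOneSpectrum (𝓞 ↥(maximalRealSubfield L)))

section AnyForm

-- The σ-algebras are IMPLICIT arguments (Mathlib's `{_ : MeasurableSpace _}` idiom), not instance arguments: at the use site they are read off `hS` ∕ `hT` by
-- unification, so the socket frame's `letI … := borel _` σ-algebras are matched WITHOUT re-declaring local instances in the consumer's proof.
variable {𝔪t : MeasurableSpace (GtLoc L v)} {𝔪 : MeasurableSpace ((cmDatum L 3 (Φ : Matrix (Fin 3) (Fin 3) L)).Local v)}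
  {𝔪tq : ∀ δ : GtLoc L v, MeasurableSpace (GtLoc L v ⧸ epsCentralizer (epsLoc L Φ v) δ)}
  {𝔪q : ∀ γ : (cmDatum L 3 (Φ : Matrix (Fin 3) (Fin 3) L)).Local v,
    MeasurableSpace ((cmDatum L 3 (Φ : Matrix (Fin 3) (Fin 3) L)).Local v ⧸
      Subgroup.centralizer ({γ} : Set ((cmDatum L 3 (Φ : Matrix (Fin 3) (Fin 3) L)).Local v)))}
  {νG : Measure ((cmDatum L 3 (Φ : Matrix (Fin 3) (Fin 3) L)).Local v)} {νGt : Measure (GtLoc L v)}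
  {mG : OrbitalMeasureFamily ((cmDatum L 3 (Φ : Matrix (Fin 3) (Fin 3) L)).Local v)} {mGt : EpsOrbitalMeasureFamily (epsLoc L Φ v) ⊥}

/-! ## §1 The (W-NP) ∃-body from the two measure-level letters (B2-S) and (B1) -/

variable {L Φ v} in
/-- **WEYL NORM PAIR FROM A STABLE-AND-TWISTED WEYL MEASURE ON THE REGULAR SET** (any form `Φ`): if `ρ` is carried by the regular semisimple set, is a stable Weyl
measure for `(νG, mG)` (p. 182) and — along a section `sec₀` of the norm map with `γ ∈ 𝒩(sec₀ γ)` for EVERY `γ` — a twisted Weyl datum for `(νGt, mGt)` (p. 186), then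
`(ρ, sec₀)` witnesses the (W-NP) body `∃ ρ sec, IsStableWeylMeasure … ρ ∧ IsTwistedWeylMeasure … ρ sec ∧ IsNormSection … ρ sec`: the norm-section conjunct IS the
a.e.-regularity of `ρ` (★ `isNormSection_iff_ae_isRegularElt`). [cite: Rogawski1990, §12.5 pp. 182, 186–187; §3.11 Prop. 3.11.1 (b) p. 34] -/
theorem exists_weylNormPair_of_stable_twisted {ρ : Measure ((cmDatum L 3 (Φ : Matrix (Fin 3) (Fin 3) L)).Local v)}
    {sec₀ : (cmDatum L 3 (Φ : Matrix (Fin 3) (Fin 3) L)).Local v → GtLoc L v}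
    (hρ : ∀ᵐ γ ∂ρ, IsRegularElt (γ.val : GL (Fin 3) (LocalRing L v))) (hS : IsStableWeylMeasure L Φ v νG mG ρ)
    (hsec₀ : ∀ γ, IsEpsNormPair L Φ v (sec₀ γ) γ) (hT : IsTwistedWeylMeasure L Φ v νGt mGt ρ sec₀) :
    ∃ (ρ : Measure ((cmDatum L 3 (Φ : Matrix (Fin 3) (Fin 3) L)).Local v)) (sec : (cmDatum L 3 (Φ : Matrix (Fin 3) (Fin 3) L)).Local v → GtLoc L v),
      IsStableWeylMeasure L Φ v νG mG ρ ∧ IsTwistedWeylMeasure L Φ v νGt mGt ρ sec ∧ IsNormSection L Φ v ρ sec :=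
  ⟨ρ, sec₀, hS, hT, (isNormSection_iff_ae_isRegularElt hsec₀ ρ).2 hρ⟩

/-! ## §2 The same, with the section of record `N(sec γ) = γ` -/

variable {L Φ v} in
/-- **WEYL NORM PAIR WITH THE SECTION OF RECORD**: under the same two letters, the (W-NP) body holds with a section `sec` satisfying IN ADDITION `N(sec γ) = (sec γ) ε_v(sec γ)
= γ` for EVERY `γ` (the global section of ★ `exists_normSection`; the twisted Weyl datum transfers from `sec₀` to it by ★ `isTwistedWeylMeasure_iff_of_forall_isEpsNormPair`,
since over a `ρ` carried by the regular set it does not see which everywhere-norm section is used). [cite: Rogawski1990, §12.5 p. 186; §3.11 Prop. 3.11.1 (b) p. 34] -/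
theorem exists_weylNormPair_normSection_of_stable_twisted {ρ : Measure ((cmDatum L 3 (Φ : Matrix (Fin 3) (Fin 3) L)).Local v)}
    {sec₀ : (cmDatum L 3 (Φ : Matrix (Fin 3) (Fin 3) L)).Local v → GtLoc L v}
    (hρ : ∀ᵐ γ ∂ρ, IsRegularElt (γ.val : GL (Fin 3) (LocalRing L v))) (hS : IsStableWeylMeasure L Φ v νG mG ρ)
    (hsec₀ : ∀ γ, IsEpsNormPair L Φ v (sec₀ γ) γ) (hT : IsTwistedWeylMeasure L Φ v νGt mGt ρ sec₀) :
    ∃ (ρ : Measure ((cmDatum L 3 (Φ : Matrix (Fin 3) (Fin 3) L)).Local v)) (sec : (cmDatum L 3 (Φ : Matrix (Fin 3) (Fin 3) L)).Local v → GtLoc L v),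
      IsStableWeylMeasure L Φ v νG mG ρ ∧ IsTwistedWeylMeasure L Φ v νGt mGt ρ sec ∧ IsNormSection L Φ v ρ sec ∧
        ∀ γ, epsNorm (epsLoc L Φ v) (sec γ) = γ.val := by
  obtain ⟨sec, hsec⟩ := exists_normSection L Φ v
  exact ⟨ρ, sec, hS, (isTwistedWeylMeasure_iff_of_forall_isEpsNormPair hρ hsec₀ fun γ => (hsec γ).2).1 hT,
    (isNormSection_iff_ae_isRegularElt (fun γ => (hsec γ).2) ρ).2 hρ, fun γ => (hsec γ).1⟩

/-! ## §3 The cut is lossless: (W-NP) ⟺ the two letters on a `ρ` carried by the regular set -/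

variable {L Φ v} in
/-- **ANY twisted Weyl datum with a norm section moves to the section of record**: if `(ρ, sec)` is a twisted Weyl datum with `sec` a norm section over `ρ`, then `ρ` is
carried by the regular set and `(ρ, sec′)` is a twisted Weyl datum for EVERY section `sec′` with `γ ∈ 𝒩(sec′ γ)` everywhere (★ `IsNormSection.ae_isRegularElt`,
★ `IsTwistedWeylMeasure.congr_normSection`). [cite: Rogawski1990, §12.5 p. 186; §3.11 Prop. 3.11.1 (b) p. 34] -/
theorem IsTwistedWeylMeasure.of_isNormSection_of_forall_isEpsNormPair {ρ : Measure ((cmDatum L 3 (Φ : Matrix (Fin 3) (Fin 3) L)).Local v)}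
    {sec sec' : (cmDatum L 3 (Φ : Matrix (Fin 3) (Fin 3) L)).Local v → GtLoc L v}
    (hT : IsTwistedWeylMeasure L Φ v νGt mGt ρ sec) (hN : IsNormSection L Φ v ρ sec) (hsec' : ∀ γ, IsEpsNormPair L Φ v (sec' γ) γ) :
    (∀ᵐ γ ∂ρ, IsRegularElt (γ.val : GL (Fin 3) (LocalRing L v))) ∧ IsTwistedWeylMeasure L Φ v νGt mGt ρ sec' :=
  ⟨hN.ae_isRegularElt, hT.congr_normSection hN ((isNormSection_iff_ae_isRegularElt hsec' ρ).2 hN.ae_isRegularElt)⟩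

/-- **THE (W-NP) CUT IS LOSSLESS** (any form `Φ`): the (W-NP) ∃-body `∃ ρ sec, IsStableWeylMeasure … ρ ∧ IsTwistedWeylMeasure … ρ sec ∧ IsNormSection … ρ sec` holds iff
there are a measure `ρ` CARRIED BY THE REGULAR SET and a section `sec` with `γ ∈ 𝒩(sec γ)` EVERYWHERE such that `ρ` is a stable Weyl measure and `(ρ, sec)` a twisted Weyl
datum — i.e. iff the two measure-level letters (B2-S), (B1) hold on a common `ρ` (`⇒`: a.e.-regularity from the norm section, then move T-WIF to the global section of
★ `exists_normSection`; `⇐`: §1). [cite: Rogawski1990, §12.5 pp. 182, 186–187; §3.11 Prop. 3.11.1 (b) p. 34; §4.3 p. 43] -/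
theorem weylNormPair_iff_exists_ae_isRegularElt :
    (∃ (ρ : Measure ((cmDatum L 3 (Φ : Matrix (Fin 3) (Fin 3) L)).Local v)) (sec : (cmDatum L 3 (Φ : Matrix (Fin 3) (Fin 3) L)).Local v → GtLoc L v),
      IsStableWeylMeasure L Φ v νG mG ρ ∧ IsTwistedWeylMeasure L Φ v νGt mGt ρ sec ∧ IsNormSection L Φ v ρ sec) ↔
    ∃ (ρ : Measure ((cmDatum L 3 (Φ : Matrix (Fin 3) (Fin 3) L)).Local v)) (sec : (cmDatum L 3 (Φ : Matrix (Fin 3) (Fin 3) L)).Local v → GtLoc L v),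
      (∀ γ, IsEpsNormPair L Φ v (sec γ) γ) ∧ (∀ᵐ γ ∂ρ, IsRegularElt (γ.val : GL (Fin 3) (LocalRing L v))) ∧
        IsStableWeylMeasure L Φ v νG mG ρ ∧ IsTwistedWeylMeasure L Φ v νGt mGt ρ sec := by
  refine ⟨fun ⟨ρ, sec, hS, hT, hN⟩ => ?_, fun ⟨ρ, sec, hsec, hρ, hS, hT⟩ => exists_weylNormPair_of_stable_twisted hρ hS hsec hT⟩
  obtain ⟨sec', hsec'⟩ := exists_normSection L Φ v
  obtain ⟨hρ, hT'⟩ := hT.of_isNormSection_of_forall_isEpsNormPair hN fun γ => (hsec' γ).2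
  exact ⟨ρ, sec', fun γ => (hsec' γ).2, hρ, hS, hT'⟩

end AnyForm

/-! ## §4 At the form of record `splitFormGL L`: the (W-NP) socket's ∃-body, token for token -/

section FormOfRecord

variable {L v}
variable {𝔪t : MeasurableSpace (GtLoc L v)} {𝔪 : MeasurableSpace ((cmDatum L 3 (splitFormGL L : Matrix (Fin 3) (Fin 3) L)).Local v)}
  {𝔪tq : ∀ δ : GtLoc L v, MeasurableSpace (GtLoc L v ⧸ epsCentralizer (epsLoc L (splitFormGL L) v) δ)}
  {𝔪q : ∀ γ : (cmDatum L 3 (splitFormGL L : Matrix (Fin 3) (Fin 3) L)).Local v,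
    MeasurableSpace ((cmDatum L 3 (splitFormGL L : Matrix (Fin 3) (Fin 3) L)).Local v ⧸
      Subgroup.centralizer ({γ} : Set ((cmDatum L 3 (splitFormGL L : Matrix (Fin 3) (Fin 3) L)).Local v)))}
  {νG : Measure ((cmDatum L 3 (splitFormGL L : Matrix (Fin 3) (Fin 3) L)).Local v)} {νGt : Measure (GtLoc L v)}
  {mG : OrbitalMeasureFamily ((cmDatum L 3 (splitFormGL L : Matrix (Fin 3) (Fin 3) L)).Local v)}
  {mGt : EpsOrbitalMeasureFamily (epsLoc L (splitFormGL L) v) ⊥}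
  {ρ : Measure ((cmDatum L 3 (splitFormGL L : Matrix (Fin 3) (Fin 3) L)).Local v)}
  {sec₀ : (cmDatum L 3 (splitFormGL L : Matrix (Fin 3) (Fin 3) L)).Local v → GtLoc L v}

/-- **(W-NP ↓) «WEYL NORM PAIR OF STABLE ∧ TWISTED» — THE DEALT REDUCTION AT THE FORM OF RECORD** (S4 dealer K2E2-plan (g7), S4-R18 (3)): at `Φ := splitFormGL L`,
from (B2-S) «`ρ` is a stable Weyl measure for `(νG, mG)`» with `ρ` carried by the regular set (`hρ`, exported by ★ `exists_isPlainWeylMeasure` for the plain measure and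
kept by the stable regrouping) and (B1) «`(ρ, sec₀)` is a twisted Weyl datum for `(νGt, mGt)`» along ANY section `sec₀` with `γ ∈ 𝒩(sec₀ γ)` for every `γ` (`hsec₀`;
e.g. the global section of ★ `exists_normSection`), conclude the ∃-BODY of the socket `stub_R90_S4_weylNormPair` of `Lines/R90_S4_LocalBaseChangeC.lean` ED. 5 TOKEN FOR
TOKEN — so that C pays (W-NP) by `obtain` + `exact` and ★ `oneDimCharTransfer_of_weylPair` pays (1D-CT)ₙₛ from it.  The measure pins of the socket frame (`IsCanonical`,
`IsEpsCanonicalAt`, Haar) are not consumed here: they are what lets ONE `ρ` satisfy both letters (§4.3 p. 43 «compatible measures») and belong to whoever supplies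
`hS` and `hT`. [cite: Rogawski1990, §12.5 pp. 182, 186–187; §3.11 Prop. 3.11.1 (b) p. 34; §4.3 p. 43] -/
theorem weylNormPair_of_stable_twisted (hρ : ∀ᵐ γ ∂ρ, IsRegularElt (γ.val : GL (Fin 3) (LocalRing L v)))
    (hS : IsStableWeylMeasure L (splitFormGL L) v νG mG ρ) (hsec₀ : ∀ γ, IsEpsNormPair L (splitFormGL L) v (sec₀ γ) γ)
    (hT : IsTwistedWeylMeasure L (splitFormGL L) v νGt mGt ρ sec₀) :
    ∃ (ρ : Measure ((cmDatum L 3 (splitFormGL L : Matrix (Fin 3) (Fin 3) L)).Local v))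
      (sec : (cmDatum L 3 (splitFormGL L : Matrix (Fin 3) (Fin 3) L)).Local v → GtLoc L v),
      IsStableWeylMeasure L (splitFormGL L) v νG mG ρ ∧ IsTwistedWeylMeasure L (splitFormGL L) v νGt mGt ρ sec ∧
        IsNormSection L (splitFormGL L) v ρ sec :=
  exists_weylNormPair_of_stable_twisted hρ hS hsec₀ hT

/-- **(W-NP ↓) WITH THE SECTION OF RECORD** at `Φ := splitFormGL L`: the same two letters give the socket's ∃-body with a section satisfying moreover `N(sec γ) = γ` for
every `γ`. [cite: Rogawski1990, §12.5 p. 186; §3.11 Prop. 3.11.1 (b) p. 34] -/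
theorem weylNormPair_normSection_of_stable_twisted (hρ : ∀ᵐ γ ∂ρ, IsRegularElt (γ.val : GL (Fin 3) (LocalRing L v)))
    (hS : IsStableWeylMeasure L (splitFormGL L) v νG mG ρ) (hsec₀ : ∀ γ, IsEpsNormPair L (splitFormGL L) v (sec₀ γ) γ)
    (hT : IsTwistedWeylMeasure L (splitFormGL L) v νGt mGt ρ sec₀) :
    ∃ (ρ : Measure ((cmDatum L 3 (splitFormGL L : Matrix (Fin 3) (Fin 3) L)).Local v))
      (sec : (cmDatum L 3 (splitFormGL L : Matrix (Fin 3) (Fin 3) L)).Local v → GtLoc L v),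
      IsStableWeylMeasure L (splitFormGL L) v νG mG ρ ∧ IsTwistedWeylMeasure L (splitFormGL L) v νGt mGt ρ sec ∧
        IsNormSection L (splitFormGL L) v ρ sec ∧ ∀ γ, epsNorm (epsLoc L (splitFormGL L) v) (sec γ) = γ.val :=
  exists_weylNormPair_normSection_of_stable_twisted hρ hS hsec₀ hT

end FormOfRecord

end Summit.HodgeConjecture.HodgeConjecture.R90.S4

end
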